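import Mathlib
import HarnessLib
import Summits.HubbardSuperconductivity.HubbardSuperconductivity.Theorems.KLProgrammePerturbedFermiCurveFrameHessBridge

/-!
# Route `KLProgramme` — ENGINE child (stmt-HubbardSuperconductivity-20437 `KLRegimeEngineV17F2`): the CAUSTIC CONVEXITY of the two-shell bound on the
# frame's Fermi curve from `C²` data + the everywhere tangential-Hessian floor (step (T2)-caustic; design note HOME/hubbard-kl-k3c2-p2/TWO-SHELL-FRAME-PORT.md §6–§8)

Cell `gate-hubbard-kl`, seat hubbard-kl-k3c2-p2 g15.  In p1b's `K = 0` chain the strict convexity `G″ ≥ c > 0` of the translated level `G(θ) = ε(p(θ) − w) − μ`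
on a caustic window (`2p(θ) ≈ w mod 2πℤ²`) comes from the explicit band (`cos`, `sin` are `1`-Lipschitz: a free `C³` bound).  For the frame band
`e_K = ε₀ − μ − K`, `K ∈ TrigPolyC4v` of UNBOUNDED degree, no `N`-uniform `C³` bound exists; but `GeomConstants (frameLevel μ K) Kc r₀ g₀ w` asserts the
tangential floor `(t, e″t) ≥ w|t|²` at EVERY point of the tube `{|e_K| < r₀}` — and that replaces the modulus of continuity of `e″`:
* §1 **`caustic_second_variation_ge`** (abstract, on `Momentum`): if `Df(P)[V] = 0`, `w‖V‖² ≤ D²f(P)[V,V]`, `D²f(P)[V,V] + Df(P)[A] = 0` (the level identities at the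
  curve point `P` with tangent `V`, acceleration `A`), `|f(Q)| < r₀` and `‖Df(Q) + Df(P)‖ ≤ γ` (odd alignment of the normals at `Q = P − W`), then
  `D²f(Q)[V,V] + Df(Q)[A] ≥ 2w‖V‖² − ((w + Kc)(γ‖V‖/g₀)² + 2Kc‖V‖·γ‖V‖/g₀ + γ‖A‖)` — decompose `V` along `∇f(Q)`; floor at `Q` on the tangential part.
* §2 the symmetry inputs for the frame band: `e_K(−X + 2πm) = e_K(X)`, `De_K(−X + 2πm) = −De_K(X)` (`frameLevel_toLp_reflect`, `fderiv_frameLevel_toLp_reflect`),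
  and the two mean-value bounds `|e_K(Y) − e_K(X)|, ‖De_K(Y) − De_K(X)‖ ≤ Kc‖Y − X‖`.
(The curve-level corollary — `G″ ≥ 2w(X_E′² + Y_E′²) − O(ρ)` on a caustic window — and the `N`-uniform acceleration bound are in
`KLProgrammePerturbedFermiCurveCausticFrame.lean`.)
Everything is PROVED; no definitions, no named facts; nothing asserts any stub or superconductivity.
References: DECOMP App. E Lemma E.3; FST II Lemma 2.1 [cite: FeldmanSalmhoferTrubowitz1998]; BGM 2006 §2.4 (2.41) [cite: BenfattoGiulianiMastropietro2006].
-/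

noncomputable section

namespace Summit.HubbardSuperconductivity.HubbardSuperconductivity.Theorems.PerturbedFermiCurve

set_option linter.dupNamespace false -- summit = problem name (single-conjunct summit), D-0017

open Real Set
open Literature.MathematicalPhysics.QuantumLattice Literature.MathematicalPhysics.QuantumLattice.BandSectorCounting
open Literature.MathematicalPhysics.QuantumLattice.FermiRG
open Summit.HubbardSuperconductivity.HubbardSuperconductivity.Theorems.DispersionFlow
open Summit.HubbardSuperconductivity.HubbardSuperconductivity.Theorems.KLRegimeSplit

/-! ## §1 The abstract second-variation bound at an odd-aligned pair of points -/

/-- **Caustic second variation.**  `f` with `GeomConstants f Kc r₀ g₀ w`; at `P`: `Df(P)[V] = 0`, `w‖V‖² ≤ D²f(P)[V,V]`, `D²f(P)[V,V] + Df(P)[A] = 0`;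
at `Q`: `|f Q| < r₀` and `‖Df(Q) + Df(P)‖ ≤ γ`.  Then
`2w‖V‖² − ((w + Kc)(γ‖V‖/g₀)² + 2Kc‖V‖(γ‖V‖/g₀) + γ‖A‖) ≤ D²f(Q)[V,V] + Df(Q)[A]`. [cite: FeldmanSalmhoferTrubowitz1998, Lemma 2.1] -/
theorem caustic_second_variation_ge {f : Momentum → ℝ} {Kc r₀ g₀ w : ℝ} (hG : GeomConstants f Kc r₀ g₀ w)
    {P Q V A : Momentum} {γ : ℝ} (hPV : fderiv ℝ f P V = 0) (hfloor : w * ‖V‖ ^ 2 ≤ fderiv ℝ (fderiv ℝ f) P V V)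
    (hid : fderiv ℝ (fderiv ℝ f) P V V + fderiv ℝ f P A = 0) (hQ : |f Q| < r₀) (hγ : ‖fderiv ℝ f Q + fderiv ℝ f P‖ ≤ γ) :
    2 * w * ‖V‖ ^ 2 - ((w + Kc) * (γ * ‖V‖ / g₀) ^ 2 + 2 * Kc * ‖V‖ * (γ * ‖V‖ / g₀) + γ * ‖A‖) ≤
      fderiv ℝ (fderiv ℝ f) Q V V + fderiv ℝ f Q A := by
  have hw : 0 < w := hG.wmin_pos
  have hg₀ : 0 < g₀ := hG.g₀_pos
  have hKc : 0 ≤ Kc := le_trans (norm_nonneg _) (hG.norm_iteratedFDeriv_le Q 0 (by norm_num))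
  have hγ0 : 0 ≤ γ := le_trans (norm_nonneg _) hγ
  set L := fderiv ℝ f Q with hL
  set BQ := fderiv ℝ (fderiv ℝ f) Q with hBQ
  -- `‖D²f(Q)‖ ≤ Kc`
  have hBQn : ‖BQ‖ ≤ Kc := by
    rw [hBQ, ← norm_iteratedFDeriv_one (𝕜 := ℝ) (f := fderiv ℝ f), norm_iteratedFDeriv_fderiv]
    exact hG.norm_iteratedFDeriv_le Q 2 le_rfl
  have hB : ∀ Y Z : Momentum, |BQ Y Z| ≤ Kc * ‖Y‖ * ‖Z‖ := by
    intro Y Z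
    rw [← Real.norm_eq_abs]
    calc ‖BQ Y Z‖ ≤ ‖BQ Y‖ * ‖Z‖ := (BQ Y).le_opNorm Z
      _ ≤ ‖BQ‖ * ‖Y‖ * ‖Z‖ := by gcongr; exact BQ.le_opNorm Y
      _ ≤ Kc * ‖Y‖ * ‖Z‖ := by gcongr
  -- the gradient at `Q`
  set gQ := gradient f Q with hgQ
  have hgQge : g₀ ≤ ‖gQ‖ := hG.le_norm_gradient Q hQ
  have hgQpos : 0 < ‖gQ‖ := hg₀.trans_le hgQge
  have hinner : ∀ Z : Momentum, inner ℝ gQ Z = L Z := fun Z => by rw [hgQ, inner_gradient_left]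
  -- `|Df(Q)[V]| ≤ γ‖V‖`
  have hLV : |L V| ≤ γ * ‖V‖ := by
    have e : L V = (fderiv ℝ f Q + fderiv ℝ f P) V := by
      rw [show (fderiv ℝ f Q + fderiv ℝ f P) V = L V + fderiv ℝ f P V from rfl, hPV, add_zero]
    rw [e, ← Real.norm_eq_abs]
    exact (ContinuousLinearMap.le_opNorm _ _).trans (mul_le_mul_of_nonneg_right hγ (norm_nonneg _))
  -- decomposition `V = T + X`, `X ∥ ∇f(Q)`, `T ⊥ ∇f(Q)`
  set c := L V / ‖gQ‖ ^ 2 with hc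
  set X : Momentum := c • gQ with hX
  set T : Momentum := V - X with hT
  have hVTX : V = T + X := by rw [hT, sub_add_cancel]
  have hg2 : (0 : ℝ) < ‖gQ‖ ^ 2 := by positivity
  have hgT : inner ℝ gQ T = 0 := by
    rw [hT, inner_sub_right, hX, real_inner_smul_right, real_inner_self_eq_norm_sq, hinner, hc,
      div_mul_cancel₀ _ hg2.ne', sub_self]
  have hXnorm : ‖X‖ = |L V| / ‖gQ‖ := by
    rw [hX, norm_smul, Real.norm_eq_abs, hc, abs_div, abs_of_pos hg2, div_mul_eq_mul_div, pow_two,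
      mul_div_mul_right _ _ hgQpos.ne']
  have hXle : ‖X‖ ≤ γ * ‖V‖ / g₀ := by
    rw [hXnorm]
    calc |L V| / ‖gQ‖ ≤ γ * ‖V‖ / ‖gQ‖ := div_le_div_of_nonneg_right hLV hgQpos.le
      _ ≤ γ * ‖V‖ / g₀ := div_le_div_of_nonneg_left (by positivity) hg₀ hgQge
  have hTX : inner ℝ T X = 0 := by
    rw [hX, real_inner_smul_right, real_inner_comm, hgT, mul_zero]
  have hpyth : ‖V‖ ^ 2 = ‖T‖ ^ 2 + ‖X‖ ^ 2 := by
    have h : ‖T + X‖ ^ 2 = ‖T‖ ^ 2 + 2 * inner ℝ T X + ‖X‖ ^ 2 := norm_add_sq_real T X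
    rw [← hVTX, hTX] at h
    linarith
  have hTle : ‖T‖ ≤ ‖V‖ := by
    have h1 : ‖T‖ ^ 2 ≤ ‖V‖ ^ 2 := by nlinarith [hpyth, sq_nonneg ‖X‖]
    exact (pow_le_pow_iff_left₀ (norm_nonneg T) (norm_nonneg V) two_ne_zero).1 h1
  -- the floor at `Q` on the tangential part
  have hfloorQ : w * ‖T‖ ^ 2 ≤ BQ T T := by
    have h := hG.le_hessQuad Q hQ T hgT
    rw [hessQuad, iteratedFDeriv_two_apply] at h
    simpa only [Matrix.cons_val_zero, Matrix.cons_val_one] using h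
  -- expansion of `D²f(Q)[V,V]`
  have hexp : BQ V V = BQ T T + BQ T X + BQ X T + BQ X X := by
    rw [hVTX, map_add, map_add]
    show (BQ T T + BQ X T) + (BQ T X + BQ X X) = _
    ring
  have h1 := (abs_le.1 (hB T X)).1
  have h2 := (abs_le.1 (hB X T)).1
  have h3 := (abs_le.1 (hB X X)).1
  have hTX1 : Kc * ‖T‖ * ‖X‖ ≤ Kc * ‖V‖ * ‖X‖ := by gcongr
  have hXT1 : Kc * ‖X‖ * ‖T‖ ≤ Kc * ‖V‖ * ‖X‖ := by rw [mul_right_comm]; exact hTX1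
  have e3 : Kc * ‖X‖ * ‖X‖ = Kc * ‖X‖ ^ 2 := by ring
  rw [e3] at h3
  have a1 : w * ‖V‖ ^ 2 - w * ‖X‖ ^ 2 ≤ BQ T T := by
    have hwT : w * ‖T‖ ^ 2 = w * ‖V‖ ^ 2 - w * ‖X‖ ^ 2 := by rw [hpyth]; ring
    rw [← hwT]; exact hfloorQ
  have a2 : -(Kc * ‖V‖ * ‖X‖) ≤ BQ T X := by linarith [h1, hTX1]
  have a3 : -(Kc * ‖V‖ * ‖X‖) ≤ BQ X T := by linarith [h2, hXT1]
  have hBVV : w * ‖V‖ ^ 2 - (w + Kc) * ‖X‖ ^ 2 - 2 * Kc * ‖V‖ * ‖X‖ ≤ BQ V V := by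
    rw [hexp]
    have e4 : (w + Kc) * ‖X‖ ^ 2 = w * ‖X‖ ^ 2 + Kc * ‖X‖ ^ 2 := by ring
    rw [e4]
    linarith [a1, a2, a3, h3]
  -- the gradient term: `Df(Q)[A] = (Df(Q) + Df(P))[A] + D²f(P)[V,V]`
  have hLA : w * ‖V‖ ^ 2 - γ * ‖A‖ ≤ L A := by
    have e : L A = (fderiv ℝ f Q + fderiv ℝ f P) A - fderiv ℝ f P A := by
      rw [show (fderiv ℝ f Q + fderiv ℝ f P) A = L A + fderiv ℝ f P A from rfl]; ring
    have hb : |(fderiv ℝ f Q + fderiv ℝ f P) A| ≤ γ * ‖A‖ := by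
      rw [← Real.norm_eq_abs]
      exact (ContinuousLinearMap.le_opNorm _ _).trans (mul_le_mul_of_nonneg_right hγ (norm_nonneg _))
    have hPA : fderiv ℝ f P A = -(fderiv ℝ (fderiv ℝ f) P V V) := by linarith [hid]
    rw [e, hPA]
    linarith [(abs_le.1 hb).1, hfloor]
  -- monotonicity in `‖X‖ ≤ γ‖V‖/g₀`
  have hmono : (w + Kc) * ‖X‖ ^ 2 + 2 * Kc * ‖V‖ * ‖X‖ ≤
      (w + Kc) * (γ * ‖V‖ / g₀) ^ 2 + 2 * Kc * ‖V‖ * (γ * ‖V‖ / g₀) := by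
    have hsq : ‖X‖ ^ 2 ≤ (γ * ‖V‖ / g₀) ^ 2 := pow_le_pow_left₀ (norm_nonneg X) hXle 2
    have hwK : 0 ≤ w + Kc := by linarith
    have hl : 2 * Kc * ‖V‖ * ‖X‖ ≤ 2 * Kc * ‖V‖ * (γ * ‖V‖ / g₀) := by gcongr
    have hm := mul_le_mul_of_nonneg_left hsq hwK
    linarith [hm, hl]
  linarith [hBVV, hLA, hmono]

/-! ## §2 The frame band: reflection symmetry and mean-value bounds -/

/-- **The frame band is even and `2πℤ²`-periodic (reflected form)**: `e_K(toLp(−x + 2πm)) = e_K(toLp x)`. [folklore] -/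
theorem frameLevel_toLp_reflect (μ : ℝ) (K : TrigPolyC4v) (x : Fin 2 → ℝ) (m : Fin 2 → ℤ) :
    frameLevel μ K (WithLp.toLp 2 (fun i => -x i + m i * (2 * π))) = frameLevel μ K (WithLp.toLp 2 x) := by
  rw [frameLevel_toLp, frameLevel_toLp]
  have hK : K.eval (fun i => -x i + m i * (2 * π)) = K.eval x := by
    have h1 := TrigPolyC4v.eval_periodic K (-x) m
    have e : (fun i => (-x) i + (m i : ℝ) * (2 * π)) = fun i => -x i + m i * (2 * π) := by funext i; simp
    rw [e] at h1
    rw [h1, TrigPolyC4v.eval_neg]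
  have hc : ∀ i : Fin 2, Real.cos (-x i + m i * (2 * π)) = Real.cos (x i) := fun i => by
    rw [Real.cos_add_int_mul_two_pi, Real.cos_neg]
  simp only [sqDispersion, frameShift_toLp, hK, hc]

/-- **The gradient of the frame band is odd under the reflection**: `De_K(toLp(−x + 2πm)) = −De_K(toLp x)` (as continuous linear maps on `Momentum`). [folklore] -/
theorem fderiv_frameLevel_toLp_reflect (μ : ℝ) (K : TrigPolyC4v) (x : Fin 2 → ℝ) (m : Fin 2 → ℤ) :
    fderiv ℝ (frameLevel μ K) (WithLp.toLp 2 (fun i => -x i + m i * (2 * π))) = -fderiv ℝ (frameLevel μ K) (WithLp.toLp 2 x) := by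
  set f := frameLevel μ K with hf
  set C : Momentum := WithLp.toLp 2 (fun i => (m i : ℝ) * (2 * π)) with hC
  set N : Momentum → Momentum := fun X => -X + C with hN
  -- `f ∘ N = f`
  have hfN : f ∘ N = f := by
    funext X
    simp only [Function.comp_apply, hN]
    have hX : X = WithLp.toLp 2 (WithLp.ofLp X) := (WithLp.toLp_ofLp (p := 2) X).symm
    rw [hX, hC, ← WithLp.toLp_neg, ← WithLp.toLp_add]
    have e : (-(WithLp.ofLp X) + fun i => (m i : ℝ) * (2 * π)) = fun i => -(WithLp.ofLp X) i + m i * (2 * π) := by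
      funext i; simp
    rw [e, hf, frameLevel_toLp_reflect]
  have hcd2 : ContDiff ℝ 2 f := by
    rw [hf, frameLevel_eq_add]; exact (klfs_contDiff_e μ).add (contDiff_frameShift K)
  have hcd : Differentiable ℝ f := hcd2.differentiable (by norm_num)
  have hNd : ∀ X, HasFDerivAt N (-(ContinuousLinearMap.id ℝ Momentum)) X := fun X =>
    ((hasFDerivAt_id (𝕜 := ℝ) X).neg).add_const C
  have hNx : N (WithLp.toLp 2 x) = WithLp.toLp 2 (fun i => -x i + m i * (2 * π)) := by
    simp only [hN, hC]
    rw [← WithLp.toLp_neg, ← WithLp.toLp_add]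
    rfl
  -- chain rule at `toLp x`
  have hchain : HasFDerivAt (f ∘ N) ((fderiv ℝ f (N (WithLp.toLp 2 x))).comp (-(ContinuousLinearMap.id ℝ Momentum))) (WithLp.toLp 2 x) :=
    (hcd _).hasFDerivAt.comp _ (hNd _)
  rw [hfN] at hchain
  have heq := hchain.fderiv
  rw [ContinuousLinearMap.comp_neg, ContinuousLinearMap.comp_id, hNx] at heq
  rw [heq, neg_neg]

/-- **Mean-value bound for the frame band**: `|e_K(Y) − e_K(X)| ≤ Kc‖Y − X‖` (`‖De_K‖ ≤ Kc`). [folklore] -/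
theorem abs_frameLevel_sub_le {μ : ℝ} {K : TrigPolyC4v} {Kc r₀ g₀ w : ℝ} (hG : GeomConstants (frameLevel μ K) Kc r₀ g₀ w)
    (X Y : Momentum) : |frameLevel μ K Y - frameLevel μ K X| ≤ Kc * ‖Y - X‖ := by
  have hcd2 : ContDiff ℝ 2 (frameLevel μ K) := by
    rw [frameLevel_eq_add]; exact (klfs_contDiff_e μ).add (contDiff_frameShift K)
  have hcd : Differentiable ℝ (frameLevel μ K) := hcd2.differentiable (by norm_num)
  have hb : ∀ Z ∈ (Set.univ : Set Momentum), ‖fderiv ℝ (frameLevel μ K) Z‖ ≤ Kc := by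
    intro Z _
    rw [← norm_iteratedFDeriv_one (𝕜 := ℝ)]
    exact hG.norm_iteratedFDeriv_le Z 1 (by norm_num)
  have h := convex_univ.norm_image_sub_le_of_norm_fderiv_le (fun Z _ => (hcd Z)) hb (Set.mem_univ X) (Set.mem_univ Y)
  rwa [Real.norm_eq_abs] at h

/-- **Mean-value bound for the gradient of the frame band**: `‖De_K(Y) − De_K(X)‖ ≤ Kc‖Y − X‖` (`‖D²e_K‖ ≤ Kc`). [folklore] -/
theorem norm_fderiv_frameLevel_sub_le {μ : ℝ} {K : TrigPolyC4v} {Kc r₀ g₀ w : ℝ} (hG : GeomConstants (frameLevel μ K) Kc r₀ g₀ w)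
    (X Y : Momentum) : ‖fderiv ℝ (frameLevel μ K) Y - fderiv ℝ (frameLevel μ K) X‖ ≤ Kc * ‖Y - X‖ := by
  have hcd : ContDiff ℝ 2 (frameLevel μ K) := by
    rw [frameLevel_eq_add]; exact (klfs_contDiff_e μ).add (contDiff_frameShift K)
  have hd2 : ContDiff ℝ 1 (fderiv ℝ (frameLevel μ K)) := hcd.fderiv_right (by norm_num)
  have hb : ∀ Z ∈ (Set.univ : Set Momentum), ‖fderiv ℝ (fderiv ℝ (frameLevel μ K)) Z‖ ≤ Kc := by
    intro Z _
    rw [← norm_iteratedFDeriv_one (𝕜 := ℝ) (f := fderiv ℝ (frameLevel μ K)), norm_iteratedFDeriv_fderiv]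
    exact hG.norm_iteratedFDeriv_le Z 2 le_rfl
  exact convex_univ.norm_image_sub_le_of_norm_fderiv_le (fun Z _ => (hd2.differentiable one_ne_zero) Z) hb
    (Set.mem_univ X) (Set.mem_univ Y)

end Summit.HubbardSuperconductivity.HubbardSuperconductivity.Theorems.PerturbedFermiCurve

end
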